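import Literature.Analysis.Approximation.TuranNazarovZeroFree
import Literature.Analysis.Complex.HadamardMinimumModulus
import Literature.Analysis.Complex.HadamardMinimumModulusCore
import HarnessLib

/-!
# Hadamard's minimum-modulus theorem for entire functions of finite order — PROOF

`Literature/Analysis/Complex/HadamardMinimumModulusProofs.lean`.  Everything in this file is PROVED; it
DISCHARGES the named fact `Literature.Analysis.Complex.Titchmarsh1939_thm_8_711`
(`Literature/Analysis/Complex/HadamardMinimumModulus.lean`): an entire `f ≢ 0` with
`‖f z‖ ≤ C_δ e^{‖z‖^{ρ+δ}}` for every `δ > 0` (`ρ ≥ 0`) satisfies, for every `ε > 0` and every `R`,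
`|f(z)| > e^{−r^{ρ+ε}}` on a whole circle `|z| = r` with `r > R` (Titchmarsh, *The Theory of Functions*,
2nd ed. 1939, §8.711; Boas, *Entire Functions* 1954, Thm. 2.7.4 «`m(r) ≠ o(e^{−r^{ρ+ε}})`»).

## The proof given here (elementary; NOT the printed route through Hadamard's factorisation)

Fix `σ < τ` with `‖f‖ ≤ C e^{|z|^σ}` and first assume `f(0) ≠ 0` (`exists_circle_of_apply_zero_ne`,
file `HadamardMinimumModulusCore.lean`, where steps 1–5 are carried out).
For a large scale `s`:
1. extract the zeros of `f` in `|z| ≤ 3s` with multiplicities, `f = P · g`, `P(z) = ∏ (z − u)^{n_u}`,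
   `g` holomorphic and zero-free on `|z| ≤ 3s` (tree: `TuranNazarov.extract_zeros`, from Mathlib's
   `MeromorphicOn.extract_zeros_poles`);
2. Jensen's formula counts them: `N = Σ n_u ≤ log(C e^{(3es)^σ}/|f(0)|) ≤ K s^σ`
   (tree: `TuranNazarov.count_le_jensen`);
3. the Poisson–Jensen bound for the holomorphic quotient `1/g = P/f` on `|z| ≤ s`
   (tree: `log_norm_le_three_mul_of_mul_eq`, Rubel–Colliander Ch. 8):
   `log|1/g| ≤ 3 (log⁺ (6s)^N + log (C e^{(3s)^σ}) − log|f(0)|)`;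
4. a radius `t ∈ [s/2, s]` at distance `≥ η = s/(4(#T+1))` from the set `T` of moduli of the extracted
   zeros exists by pigeonhole (`exists_far_from_finset`), and there `log|P| ≥ N log η ≥ −N log(4(N+1))`;
5. the total loss is `O(s^σ log s) < (s/2)^τ ≤ t^τ` for `s` large (`loss_lt_rpow`, using
   `log s ≤ s^κ/κ`, `κ = (τ−σ)/2`).
The case `f(0) = 0` is reduced to this by dividing out `z^m` (`exists_circle`), and the named fact's
`∀ δ ∃ C_δ` hypothesis is used at `δ = ε/2` (`hadamard_minimum_modulus`, `Titchmarsh1939_thm_8_711_holds`).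

## References
* [Titchmarsh1939] E. C. Titchmarsh, *The Theory of Functions*, 2nd ed., Oxford 1939, §8.71–§8.72
  [galaxy:panama:407274568810535, chars 525900–529400].
* [Boas1954] R. P. Boas, *Entire Functions*, Academic Press 1954, Thm. 2.7.4, p. 26
  [corpus:book:boasnd-entire-functions p0026 L13–L15].
* [RubelColliander1996] L. A. Rubel, J. E. Colliander, *Entire and Meromorphic Functions*, Springer 1996,
  Ch. 8 (the Poisson–Jensen quotient bound used in step 3, via `EntireQuotientOrder.lean`).

Filed by the cell `rh-split` (seat `rh-split-typer-2` g4); first consumer: the Lagarias zero-free door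
for `E_ξ` (`Summits/RiemannHypothesis/RiemannHypothesis/Theorems/LagariasZeroFreeDoor.lean`, input
`MinModulusCircles`).
-/

noncomputable section

open Complex Metric Set Real Filter Topology

namespace Literature.Analysis.Complex

namespace HadamardMinimumModulus

open Literature.Analysis.Approximation.TuranNazarov (extract_zeros)

/-- **Hadamard's minimum-modulus theorem, general `f ≢ 0`** (reduction of the case `f(0) = 0` to
`exists_circle_of_apply_zero_ne` by dividing out `z^m`). [cite: Titchmarsh1939, §8.711; Boas1954, Thm. 2.7.4] -/
theorem exists_circle {f : ℂ → ℂ} (hf : Differentiable ℂ f) (hne : ∃ z, f z ≠ 0)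
    {σ τ C : ℝ} (hσ : 0 < σ) (hστ : σ < τ) (hC : ∀ z, ‖f z‖ ≤ C * Real.exp (‖z‖ ^ σ)) (R : ℝ) :
    ∃ r : ℝ, R < r ∧ ∀ z : ℂ, ‖z‖ = r → Real.exp (-(r ^ τ)) < ‖f z‖ := by
  classical
  have hfa : ∀ z, AnalyticAt ℂ f z := fun z ↦ hf.analyticAt z
  have hfne : f ≠ 0 := by
    obtain ⟨z, hz⟩ := hne
    exact fun h ↦ hz (by simp [h])
  obtain ⟨Z, n, h, hZ, -, -, hha, hh0, hfac⟩ := extract_zeros hfa hfne 0 (ρ := 0) (R₀ := 1) one_pos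
  obtain ⟨m, hmdef⟩ : ∃ m : ℕ, m = ∑ u ∈ Z, n u := ⟨_, rfl⟩
  have hZ0 : ∀ u ∈ Z, u = 0 := fun u hu ↦ by simpa using ((hZ u).1 hu).2
  have hP : ∀ z : ℂ, ∏ u ∈ Z, (z - u) ^ n u = z ^ m := by
    intro z
    rw [hmdef, ← Finset.prod_pow_eq_pow_sum]
    exact Finset.prod_congr rfl fun u hu ↦ by rw [hZ0 u hu, sub_zero]
  have h01 : (0 : ℂ) ∈ ball (0 : ℂ) 1 := mem_ball_self one_pos
  have hfac' : ∀ z ∈ ball (0 : ℂ) 1, f z = z ^ m * h z := fun z hz ↦ by rw [hfac z hz, hP]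
  set g : ℂ → ℂ := fun z ↦ if z = 0 then h 0 else f z / z ^ m with hgdef
  have hg_ball : ∀ z ∈ ball (0 : ℂ) 1, g z = h z := by
    intro z hz
    by_cases hz0 : z = 0
    · simp [hgdef, hz0]
    · simp only [hgdef, hz0, if_false]
      rw [hfac' z hz, mul_div_cancel_left₀ _ (pow_ne_zero _ hz0)]
  have hg_ne : ∀ z : ℂ, z ≠ 0 → g z = f z / z ^ m := fun z hz ↦ by simp [hgdef, hz]
  have hgd : Differentiable ℂ g := by
    intro z
    by_cases hz0 : z = 0
    · subst hz0
      have hev : g =ᶠ[𝓝 0] h := by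
        filter_upwards [isOpen_ball.mem_nhds h01] with w hw using hg_ball w hw
      exact (hha 0 h01).differentiableAt.congr_of_eventuallyEq hev
    · have hev : g =ᶠ[𝓝 z] fun w ↦ f w / w ^ m := by
        filter_upwards [isOpen_ne.mem_nhds hz0] with w hw using hg_ne w hw
      exact ((hf z).div ((differentiable_pow m) z) (pow_ne_zero _ hz0)).congr_of_eventuallyEq hev
  have hg0 : g 0 ≠ 0 := by
    rw [hg_ball 0 h01]; exact hh0 0 (mem_closedBall_self le_rfl)
  -- growth of `g`
  obtain ⟨C₀, hC₀⟩ :=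
    (isCompact_closedBall (0 : ℂ) 1).exists_bound_of_continuousOn hgd.continuous.continuousOn
  have hC₀0 : 0 ≤ C₀ := (norm_nonneg _).trans (hC₀ 0 (mem_closedBall_self zero_le_one))
  have hgC : ∀ z, ‖g z‖ ≤ max C C₀ * Real.exp (‖z‖ ^ σ) := by
    intro z
    have he : 1 ≤ Real.exp (‖z‖ ^ σ) := Real.one_le_exp (by positivity)
    rcases le_or_gt 1 ‖z‖ with hz1 | hz1
    · have hz0 : z ≠ 0 := by
        intro h0; rw [h0, norm_zero] at hz1; linarith
      rw [hg_ne z hz0, norm_div, norm_pow]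
      calc ‖f z‖ / ‖z‖ ^ m ≤ ‖f z‖ := div_le_self (norm_nonneg _) (one_le_pow₀ hz1)
        _ ≤ C * Real.exp (‖z‖ ^ σ) := hC z
        _ ≤ max C C₀ * Real.exp (‖z‖ ^ σ) :=
            mul_le_mul_of_nonneg_right (le_max_left _ _) (by positivity)
    · calc ‖g z‖ ≤ C₀ := hC₀ z (by rw [mem_closedBall_zero_iff]; exact hz1.le)
        _ ≤ C₀ * Real.exp (‖z‖ ^ σ) := le_mul_of_one_le_right hC₀0 he
        _ ≤ max C C₀ * Real.exp (‖z‖ ^ σ) :=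
            mul_le_mul_of_nonneg_right (le_max_right _ _) (by positivity)
  obtain ⟨r, hr, hcirc⟩ := exists_circle_of_apply_zero_ne hgd hg0 hσ hστ hgC (max R 1)
  refine ⟨r, (le_max_left _ _).trans_lt hr, fun z hz ↦ ?_⟩
  have hr1 : 1 < r := (le_max_right _ _).trans_lt hr
  have hz0 : z ≠ 0 := by
    intro h0; rw [h0, norm_zero] at hz; linarith
  have hfz : ‖f z‖ = ‖z‖ ^ m * ‖g z‖ := by
    rw [hg_ne z hz0, norm_div, norm_pow,
      mul_div_cancel₀ _ (pow_ne_zero _ (norm_ne_zero_iff.mpr hz0))]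
  calc Real.exp (-(r ^ τ)) < ‖g z‖ := hcirc z hz
    _ ≤ ‖z‖ ^ m * ‖g z‖ :=
        le_mul_of_one_le_left (norm_nonneg _) (one_le_pow₀ (by rw [hz]; exact hr1.le))
    _ = ‖f z‖ := hfz.symm

end HadamardMinimumModulus

/-- **Hadamard's minimum-modulus theorem** (Titchmarsh, *The Theory of Functions* §8.711; Boas,
*Entire Functions* Thm. 2.7.4) in the typed form of the named fact
`Literature.Analysis.Complex.Titchmarsh1939_thm_8_711`: an entire `f ≢ 0` with
`‖f z‖ ≤ C_δ exp(‖z‖^{ρ+δ})` for every `δ > 0` (`ρ ≥ 0`) has, for every `ε > 0` and every `R`, a circle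
`|z| = r`, `r > R`, on which `|f| > e^{−r^{ρ+ε}}`. [cite: Titchmarsh1939, §8.711; Boas1954, Thm. 2.7.4] -/
theorem hadamard_minimum_modulus (f : ℂ → ℂ) (ρ : ℝ) (hρ : 0 ≤ ρ) (hf : Differentiable ℂ f)
    (hne : ∃ z : ℂ, f z ≠ 0)
    (hgr : ∀ δ : ℝ, 0 < δ → ∃ C : ℝ, ∀ z : ℂ, ‖f z‖ ≤ C * Real.exp (‖z‖ ^ (ρ + δ)))
    (ε : ℝ) (hε : 0 < ε) (R : ℝ) :
    ∃ r : ℝ, R < r ∧ ∀ z : ℂ, ‖z‖ = r → Real.exp (-(r ^ (ρ + ε))) < ‖f z‖ := by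
  obtain ⟨C, hC⟩ := hgr (ε / 2) (by positivity)
  exact HadamardMinimumModulus.exists_circle hf hne (σ := ρ + ε / 2) (τ := ρ + ε) (by positivity)
    (by linarith) hC R

/-- **Discharge of the named fact `Titchmarsh1939_thm_8_711`** (Hadamard's minimum-modulus theorem,
Titchmarsh §8.711 / Boas Thm. 2.7.4): the typed statement holds. [cite: Titchmarsh1939, §8.711; Boas1954, Thm. 2.7.4] -/
theorem Titchmarsh1939_thm_8_711_holds : Titchmarsh1939_thm_8_711 :=
  hadamard_minimum_modulus


end Literature.Analysis.Complex

end
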